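import Summits.NavierStokesRegularity.OSWSelfSimilar.SheetNSLineSchochetTwoPoleReadouts
import HarnessLib

/-!
# The viscous CLM on `ℝ` (NS-type line, `a = 0`) blows up in finite time from ARBITRARILY SMALL smooth odd data:
# the Schochet–ALSS two-pole solution, assembled

HONEST FRAMING (cell ns-blowup GROUP B «PROFILE SEARCH», zone Z3, rows Z3-E12⁻ (clause (i′), «the Schochet corner a = 0 is the
divide») and Z3-U addendum A-F2 («ℝ vs 𝕋 at a = 0») of `HOME/profile/z3/CENSUS-Z3.md`; human rulings D-0035/D-0074):
**1-D MODEL (the viscous Constantin–Lax–Majda equation `ω_t = ω·Hω + ν ω_xx` on `ℝ` = gCLM/OSW at `a = 0` with constant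
viscosity, the constant-`ν` reading of the sheet's NS-type line); not Euler, not Navier–Stokes; «violates: none — MODEL».**

THE THEOREM (`viscousCLM_line_blowup_from_small_data`). For every `ν > 0` and every `ε > 0` there are `T > 0` and real
functions `ω, ωₓ, ωₓₓ : ℝ → ℝ → ℝ` (time first) such that on `0 ≤ t < T`: `∂ₓω = ωₓ`, `∂ₓωₓ = ωₓₓ`, and the viscous CLM
`∂ₜ ω(t,x) = ω(t,x)·H[ω(t,·)](x) + ν·ωₓₓ(t,x)` holds at EVERY `x` with the GENUINE Hilbert transform `H = hilbertTransform` of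
`Literature/Analysis/Fourier/HilbertTransformLine.lean`; `ω(t,·)` is odd and `≤ 0` on `(0,∞)` (Chen's blow-up class 3
[Chen 2020, Thm 1.3]) and in `L¹(ℝ)`; the datum is small in `L^∞ ∩ L¹`, `sup |ω(0,·)| ≤ ε` and `∫|ω(0,x)| dx ≤ ε`; and the
solution BLOWS UP at `T` at the NS-type rate `sup_x|ω(t,x)| ≍ (T−t)^{−2}`: `ωₓ(t,0) → −∞` and
`sup_x |ω(t,x)| → ∞` as `t ↑ T` (for every `M`, eventually some `x` has `|ω(t,x)| ≥ M`). The solution is Schochet's explicit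
two-pole solution [Schochet 1986, CPAM 39] in the corrected form of [cite: AmbroseLushnikovSiegelSilantyev2024, §5.1]: pole depths
`y₁(t) = (σ − s(t))/2`, `y₂ = y₁ + s`, `s(t) = √(s₀² + 40kνt)`, amplitude `−24kν/s`, `k = 3 + √6` (`K_+ = 24k`), blow-up time
`T = (σ² − s₀²)/(40kν) = y₁(0)y₂(0)/(10kν)` when the upper pole reaches the axis; here `y₁(0) = L`, `y₂(0) = 2L` with `L`
large (`sup|ω₀| ≤ 123ν/L²`).
CENSUS READING (MODEL): on `ℝ` the NS-type dissipation does NOT prevent the `a = 0` collapse even for arbitrarily small data —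
the kernel companion of the 𝕋-side threshold theorems `SheetNSLineTorusCascade*` (blow-up for `c ≥ 48ν`, global for `c < 12ν`):
the «ℝ: blow-up from arbitrarily small data / 𝕋: sharp threshold» contrast of the census is now kernel on both sides.
WHAT IS NOT HERE: uniqueness of classical solutions on `ℝ` (so "the" solution); `H¹` smallness (true, not typed); the
self-similar PROFILE asymptotics (only the `(T−t)^{−2}` rate); anything about Navier–Stokes. No definitions, no named facts.
bears_on: LADDER-NS N5 / zone Z3 → N1 linear core.
-/

noncomputable section

namespace Summit.NavierStokesRegularity.OSWSelfSimilar
namespace SheetNSLineSchochetTwoPole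

open _root_.MeasureTheory Set Filter Literature.Analysis.Fourier
open scoped Real Topology

/-! ### Mass: every slice is `O((x² + y²)⁻¹)`, hence in `L¹`, with `‖ω(t,·)‖₁ ≤ 24(k+1)νπ/y(t)` -/

section Mass

variable {ν k σ s₀ : ℝ} {s y : ℝ → ℝ} {ω : ℝ → ℝ → ℝ}

/-- `∫ (x² + L²)⁻¹ dx = π/L`. [folklore] -/
private theorem integral_inv_sq_add_sq {L : ℝ} (hL : 0 < L) : ∫ x : ℝ, (x ^ 2 + L ^ 2)⁻¹ = π / L := by
  have e : (fun x : ℝ => (x ^ 2 + L ^ 2)⁻¹) = fun x => (L ^ 2)⁻¹ * (1 + (x / L) ^ 2)⁻¹ := by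
    funext x
    have hL2 : L ^ 2 ≠ 0 := by positivity
    field_simp
    ring
  rw [e, integral_const_mul, Measure.integral_comp_div (fun u : ℝ => (1 + u ^ 2)⁻¹) L,
    integral_univ_inv_one_add_sq, abs_of_pos hL, smul_eq_mul]
  field_simp

/-- `(x² + L²)⁻¹ ∈ L¹(ℝ)`. [folklore] -/
private theorem integrable_inv_sq_add_sq' {L : ℝ} (hL : 0 < L) : Integrable fun x : ℝ => (x ^ 2 + L ^ 2)⁻¹ := by
  have h := (integrable_inv_one_add_sq.comp_div hL.ne').const_mul (L ^ 2)⁻¹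
  refine h.congr (Eventually.of_forall fun x => ?_)
  have hL2 : L ^ 2 ≠ 0 := by positivity
  simp only
  field_simp
  ring

/-- `|x/(x²+y²) − x/(x²+(y+s)²)| ≤ s/(x²+y²)` for `y, s > 0`. [folklore] -/
theorem abs_f_sub_f_le {y s : ℝ} (hy : 0 < y) (hs : 0 < s) (x : ℝ) :
    |x / (x ^ 2 + y ^ 2) - x / (x ^ 2 + (y + s) ^ 2)| ≤ s / (x ^ 2 + y ^ 2) := by
  have h1 : (0:ℝ) < x ^ 2 + y ^ 2 := by positivity
  have h2 : (0:ℝ) < x ^ 2 + (y + s) ^ 2 := by positivity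
  have e : x / (x ^ 2 + y ^ 2) - x / (x ^ 2 + (y + s) ^ 2)
      = x * (s * (2 * y + s)) / ((x ^ 2 + y ^ 2) * (x ^ 2 + (y + s) ^ 2)) := by
    field_simp
    ring
  rw [e, abs_div, abs_mul, abs_of_pos (by positivity : (0:ℝ) < s * (2 * y + s)),
    abs_of_pos (by positivity : (0:ℝ) < (x ^ 2 + y ^ 2) * (x ^ 2 + (y + s) ^ 2)),
    div_le_div_iff₀ (by positivity) h1]
  have key : |x| * (2 * y + s) ≤ x ^ 2 + (y + s) ^ 2 := by
    nlinarith [sq_nonneg (|x| - (2 * y + s) / 2), sq_abs x, hy.le, hs.le]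
  calc |x| * (s * (2 * y + s)) * (x ^ 2 + y ^ 2) = s * (x ^ 2 + y ^ 2) * (|x| * (2 * y + s)) := by ring
    _ ≤ s * (x ^ 2 + y ^ 2) * (x ^ 2 + (y + s) ^ 2) := by gcongr
    _ = s * ((x ^ 2 + y ^ 2) * (x ^ 2 + (y + s) ^ 2)) := by ring

/-- `|2Lx/(x²+L²)²| ≤ (x²+L²)⁻¹`. [folklore] -/
theorem abs_g_le_inv {L : ℝ} (hL : 0 < L) (x : ℝ) : |2 * L * x / (x ^ 2 + L ^ 2) ^ 2| ≤ (x ^ 2 + L ^ 2)⁻¹ := by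
  have hD : (0:ℝ) < x ^ 2 + L ^ 2 := by positivity
  rw [abs_div, abs_of_pos (by positivity : (0:ℝ) < (x ^ 2 + L ^ 2) ^ 2), abs_mul,
    abs_of_pos (by positivity : (0:ℝ) < 2 * L), inv_eq_one_div, div_le_div_iff₀ (by positivity) hD]
  have h1 : 2 * L * |x| ≤ x ^ 2 + L ^ 2 := by nlinarith [sq_nonneg (|x| - L), sq_abs x]
  calc 2 * L * |x| * (x ^ 2 + L ^ 2) ≤ (x ^ 2 + L ^ 2) * (x ^ 2 + L ^ 2) := by gcongr
    _ = 1 * (x ^ 2 + L ^ 2) ^ 2 := by ring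

/-- **Lorentzian envelope of a slice:** `|ω(t, x)| ≤ 24(k+1)ν·(x² + y(t)²)⁻¹`. [folklore] -/
theorem solution_abs_le_lorentzian (hν : 0 < ν) (hk0 : 0 < k)
    (hω : ∀ t x, ω t x = (-24 * k * ν / s t) * (x / (x ^ 2 + y t ^ 2) - x / (x ^ 2 + (y t + s t) ^ 2))
      + (-12 * ν) * (2 * y t * x / (x ^ 2 + y t ^ 2) ^ 2 + 2 * (y t + s t) * x / (x ^ 2 + (y t + s t) ^ 2) ^ 2))
    {t : ℝ} (hyt : 0 < y t) (hst : 0 < s t) (x : ℝ) :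
    |ω t x| ≤ 24 * (k + 1) * ν * (x ^ 2 + y t ^ 2)⁻¹ := by
  rw [hω]
  have hy2 : 0 < y t + s t := by linarith
  have hA : |(-24 * k * ν / s t)| = 24 * k * ν / s t := by
    rw [abs_of_neg (div_neg_of_neg_of_pos (by nlinarith [mul_pos hk0 hν]) hst)]
    ring
  have hB : |(-12 * ν : ℝ)| = 12 * ν := by
    rw [abs_of_neg (by linarith)]
    ring
  have p1 := abs_f_sub_f_le hyt hst x
  have p3 := abs_g_le_inv hyt x
  have p4 : |2 * (y t + s t) * x / (x ^ 2 + (y t + s t) ^ 2) ^ 2| ≤ (x ^ 2 + y t ^ 2)⁻¹ :=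
    (abs_g_le_inv hy2 x).trans (by
      rw [inv_le_inv₀ (by positivity) (by positivity)]
      nlinarith)
  have hsne : s t ≠ 0 := hst.ne'
  calc |(-24 * k * ν / s t) * (x / (x ^ 2 + y t ^ 2) - x / (x ^ 2 + (y t + s t) ^ 2))
        + (-12 * ν) * (2 * y t * x / (x ^ 2 + y t ^ 2) ^ 2 + 2 * (y t + s t) * x / (x ^ 2 + (y t + s t) ^ 2) ^ 2)|
      ≤ |(-24 * k * ν / s t) * (x / (x ^ 2 + y t ^ 2) - x / (x ^ 2 + (y t + s t) ^ 2))|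
        + |(-12 * ν) * (2 * y t * x / (x ^ 2 + y t ^ 2) ^ 2 + 2 * (y t + s t) * x / (x ^ 2 + (y t + s t) ^ 2) ^ 2)| :=
        abs_add_le _ _
    _ = 24 * k * ν / s t * |x / (x ^ 2 + y t ^ 2) - x / (x ^ 2 + (y t + s t) ^ 2)|
        + 12 * ν * |2 * y t * x / (x ^ 2 + y t ^ 2) ^ 2 + 2 * (y t + s t) * x / (x ^ 2 + (y t + s t) ^ 2) ^ 2| := by
        rw [abs_mul, abs_mul, hA, hB]
    _ ≤ 24 * k * ν / s t * (s t / (x ^ 2 + y t ^ 2)) + 12 * ν * ((x ^ 2 + y t ^ 2)⁻¹ + (x ^ 2 + y t ^ 2)⁻¹) := by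
        gcongr
        exact (abs_add_le _ _).trans (add_le_add p3 p4)
    _ = 24 * (k + 1) * ν * (x ^ 2 + y t ^ 2)⁻¹ := by
        field_simp
        ring

/-- **Every slice is in `L¹(ℝ)`** (given continuity, which the `x`-derivative provides). [folklore] -/
theorem integrable_solution (hν : 0 < ν) (hk0 : 0 < k)
    (hω : ∀ t x, ω t x = (-24 * k * ν / s t) * (x / (x ^ 2 + y t ^ 2) - x / (x ^ 2 + (y t + s t) ^ 2))
      + (-12 * ν) * (2 * y t * x / (x ^ 2 + y t ^ 2) ^ 2 + 2 * (y t + s t) * x / (x ^ 2 + (y t + s t) ^ 2) ^ 2))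
    {t : ℝ} (hyt : 0 < y t) (hst : 0 < s t) (hcont : Continuous (ω t)) : Integrable (ω t) := by
  refine Integrable.mono' ((integrable_inv_sq_add_sq' hyt).const_mul (24 * (k + 1) * ν))
    hcont.aestronglyMeasurable (Eventually.of_forall fun x => ?_)
  rw [Real.norm_eq_abs]
  exact solution_abs_le_lorentzian hν hk0 hω hyt hst x

/-- **`L¹` norm of a slice:** `∫ |ω(t, x)| dx ≤ 24(k+1)ν·π/y(t)`. [folklore] -/
theorem integral_abs_solution_le (hν : 0 < ν) (hk0 : 0 < k)
    (hω : ∀ t x, ω t x = (-24 * k * ν / s t) * (x / (x ^ 2 + y t ^ 2) - x / (x ^ 2 + (y t + s t) ^ 2))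
      + (-12 * ν) * (2 * y t * x / (x ^ 2 + y t ^ 2) ^ 2 + 2 * (y t + s t) * x / (x ^ 2 + (y t + s t) ^ 2) ^ 2))
    {t : ℝ} (hyt : 0 < y t) (hst : 0 < s t) (hcont : Continuous (ω t)) :
    ∫ x, |ω t x| ≤ 24 * (k + 1) * ν * (π / y t) := by
  have hI := integrable_solution hν hk0 hω hyt hst hcont
  calc ∫ x, |ω t x| ≤ ∫ x, 24 * (k + 1) * ν * (x ^ 2 + y t ^ 2)⁻¹ :=
        integral_mono hI.abs ((integrable_inv_sq_add_sq' hyt).const_mul _)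
          fun x => solution_abs_le_lorentzian hν hk0 hω hyt hst x
    _ = 24 * (k + 1) * ν * (π / y t) := by
        rw [integral_const_mul, integral_inv_sq_add_sq hyt]

end Mass

/-! ### The theorem: finite-time blow-up of the viscous CLM on `ℝ` from arbitrarily small smooth odd data -/

/-- `k = 3 + √6` solves `k² − 6k + 3 = 0`, and `0 < k ≤ 6`. [folklore] -/
theorem root_k : (3 + Real.sqrt 6) ^ 2 - 6 * (3 + Real.sqrt 6) + 3 = 0 ∧ 0 < 3 + Real.sqrt 6 ∧ 3 + Real.sqrt 6 ≤ 6 := by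
  have h6 : Real.sqrt 6 ^ 2 = 6 := Real.sq_sqrt (by norm_num)
  have hs0 : 0 ≤ Real.sqrt 6 := Real.sqrt_nonneg 6
  refine ⟨by nlinarith, by positivity, ?_⟩
  nlinarith

/-- **Finite-time blow-up of the viscous CLM on `ℝ` (gCLM/OSW at `a = 0`, constant viscosity — the NS-type line) from
ARBITRARILY SMALL smooth odd class-3 data.** For every `ν > 0` and `ε > 0` there are `T > 0` and `ω, ωₓ, ωₓₓ : ℝ → ℝ → ℝ`
(time first) with, for all `0 ≤ t < T` and all `x`: `∂ₓ ω(t,·) = ωₓ(t,·)`, `∂ₓ ωₓ(t,·) = ωₓₓ(t,·)`, and the viscous CLM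
`∂ₜ ω(t,x) = ω(t,x)·H[ω(t,·)](x) + ν·ωₓₓ(t,x)` with the GENUINE `H = hilbertTransform`; every slice is odd and `≤ 0` on
`(0, ∞)` and in `L¹(ℝ)`; the datum is small in `L^∞ ∩ L¹`: `sup |ω(0,·)| ≤ ε` and `∫|ω(0,x)|dx ≤ ε`; and at `T`
the solution blows up: `ωₓ(t,0) → −∞` and for every `M` eventually (as `t ↑ T`)
some `x` has `|ω(t,x)| ≥ M`, at the exactly NS-type RATE `c (T−t)^{−2} ≤ sup_x |ω(t,x)| ≤ C (T−t)^{−2}` (`c > 0`; sheet reading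
`C_ω = (T−t)^{−2}`, `C_l = T − t`, `c_l/c_ω = 1/2` = the Schochet corner of `SheetNSLineSchochetCorner`). The witness is
Schochet's two-pole solution (`y₁(0) = L`, `y₂(0) = 2L`, `k = 3 + √6`,
`T = L²/(5kν)`, `L = √(123ν/ε) + 672ν/ε + 1`). MODEL statement; the 𝕋-side companions are `SheetNSLineTorusCascade*`.
[cite: AmbroseLushnikovSiegelSilantyev2024, §5.1 («finite-time blow up starting from arbitrarily small data for the problem on
the real line»; Schochet 1986)] -/
theorem viscousCLM_line_blowup_from_small_data (ν ε : ℝ) (hν : 0 < ν) (hε : 0 < ε) :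
    ∃ T : ℝ, 0 < T ∧ ∃ ω ωx ωxx : ℝ → ℝ → ℝ,
      (∀ t x, 0 ≤ t → t < T → HasDerivAt (ω t) (ωx t x) x) ∧
      (∀ t x, 0 ≤ t → t < T → HasDerivAt (ωx t) (ωxx t x) x) ∧
      (∀ t x, 0 ≤ t → t < T →
        HasDerivAt (fun τ => ω τ x) (ω t x * hilbertTransform (ω t) x + ν * ωxx t x) t) ∧
      (∀ t x, ω t (-x) = -ω t x) ∧
      (∀ t x, 0 ≤ t → t < T → 0 < x → ω t x ≤ 0) ∧
      (∀ x, |ω 0 x| ≤ ε) ∧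
      (∀ t, 0 ≤ t → t < T → Integrable (ω t)) ∧
      (∫ x, |ω 0 x| ≤ ε) ∧
      (∃ c C : ℝ, 0 < c ∧ ∀ t, 0 ≤ t → t < T →
        (∃ x, c / (T - t) ^ 2 ≤ |ω t x|) ∧ ∀ x, |ω t x| ≤ C / (T - t) ^ 2) ∧
      Tendsto (fun t => ωx t 0) (𝓝[<] T) atBot ∧
      (∀ M : ℝ, ∀ᶠ t in 𝓝[<] T, ∃ x : ℝ, M ≤ |ω t x|) := by
  obtain ⟨hk, hk0, hk6⟩ := root_k
  set k : ℝ := 3 + Real.sqrt 6 with hkdef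
  set L : ℝ := Real.sqrt (123 * ν / ε) + 672 * ν / ε + 1 with hLdef
  have hL : 0 < L := by positivity
  -- pole motion and the solution family
  set s : ℝ → ℝ := fun t => Real.sqrt (L ^ 2 + 40 * k * ν * t) with hsdef
  set y : ℝ → ℝ := fun t => (3 * L - s t) / 2 with hydef
  set ω : ℝ → ℝ → ℝ := fun t x => (-24 * k * ν / s t) * (x / (x ^ 2 + y t ^ 2) - x / (x ^ 2 + (y t + s t) ^ 2))
      + (-12 * ν) * (2 * y t * x / (x ^ 2 + y t ^ 2) ^ 2 + 2 * (y t + s t) * x / (x ^ 2 + (y t + s t) ^ 2) ^ 2)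
    with hωdef
  set ωx : ℝ → ℝ → ℝ := fun t x => (-24 * k * ν / s t) * ((y t ^ 2 - x ^ 2) / (x ^ 2 + y t ^ 2) ^ 2
        - ((y t + s t) ^ 2 - x ^ 2) / (x ^ 2 + (y t + s t) ^ 2) ^ 2)
      + (-12 * ν) * (2 * y t * (y t ^ 2 - 3 * x ^ 2) / (x ^ 2 + y t ^ 2) ^ 3
        + 2 * (y t + s t) * ((y t + s t) ^ 2 - 3 * x ^ 2) / (x ^ 2 + (y t + s t) ^ 2) ^ 3) with hωxdef
  set ωxx : ℝ → ℝ → ℝ := fun t x => (-24 * k * ν / s t) * (2 * x * (x ^ 2 - 3 * y t ^ 2) / (x ^ 2 + y t ^ 2) ^ 3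
        - 2 * x * (x ^ 2 - 3 * (y t + s t) ^ 2) / (x ^ 2 + (y t + s t) ^ 2) ^ 3)
      + (-12 * ν) * (24 * y t * x * (x ^ 2 - y t ^ 2) / (x ^ 2 + y t ^ 2) ^ 4
        + 24 * (y t + s t) * x * (x ^ 2 - (y t + s t) ^ 2) / (x ^ 2 + (y t + s t) ^ 2) ^ 4) with hωxxdef
  have hs : ∀ t, s t = Real.sqrt (L ^ 2 + 40 * k * ν * t) := fun t => rfl
  have hy : ∀ t, y t = (3 * L - s t) / 2 := fun t => rfl
  have hω : ∀ t x, ω t x = (-24 * k * ν / s t) * (x / (x ^ 2 + y t ^ 2) - x / (x ^ 2 + (y t + s t) ^ 2))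
      + (-12 * ν) * (2 * y t * x / (x ^ 2 + y t ^ 2) ^ 2 + 2 * (y t + s t) * x / (x ^ 2 + (y t + s t) ^ 2) ^ 2) :=
    fun t x => rfl
  have hωx : ∀ t x, ωx t x = (-24 * k * ν / s t) * ((y t ^ 2 - x ^ 2) / (x ^ 2 + y t ^ 2) ^ 2
        - ((y t + s t) ^ 2 - x ^ 2) / (x ^ 2 + (y t + s t) ^ 2) ^ 2)
      + (-12 * ν) * (2 * y t * (y t ^ 2 - 3 * x ^ 2) / (x ^ 2 + y t ^ 2) ^ 3
        + 2 * (y t + s t) * ((y t + s t) ^ 2 - 3 * x ^ 2) / (x ^ 2 + (y t + s t) ^ 2) ^ 3) := fun t x => rfl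
  have hωxx : ∀ t x, ωxx t x = (-24 * k * ν / s t) * (2 * x * (x ^ 2 - 3 * y t ^ 2) / (x ^ 2 + y t ^ 2) ^ 3
        - 2 * x * (x ^ 2 - 3 * (y t + s t) ^ 2) / (x ^ 2 + (y t + s t) ^ 2) ^ 3)
      + (-12 * ν) * (24 * y t * x * (x ^ 2 - y t ^ 2) / (x ^ 2 + y t ^ 2) ^ 4
        + 24 * (y t + s t) * x * (x ^ 2 - (y t + s t) ^ 2) / (x ^ 2 + (y t + s t) ^ 2) ^ 4) := fun t x => rfl
  -- the blow-up time `T = ((3L)² − L²)/(40kν)`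
  have hσ : (0:ℝ) < 3 * L := by positivity
  have hT : 0 < ((3 * L) ^ 2 - L ^ 2) / (40 * k * ν) := blowupTime_pos hν hk0 hL (by linarith)
  -- positivity facts on `0 ≤ t < T`
  have hrad : ∀ t, 0 ≤ t → 0 < L ^ 2 + 40 * k * ν * t := fun t ht => radicand_pos hν hk0 hL ht
  have hst : ∀ t, 0 ≤ t → 0 < s t := fun t ht => sep_pos hs (hrad t ht)
  have hyt : ∀ t, t < ((3 * L) ^ 2 - L ^ 2) / (40 * k * ν) → 0 < y t :=
    fun t ht => depth_pos hν hk0 hσ hs hy ht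
  refine ⟨((3 * L) ^ 2 - L ^ 2) / (40 * k * ν), hT, ω, ωx, ωxx, ?_, ?_, ?_, ?_, ?_, ?_, ?_, ?_, ?_, ?_, ?_⟩
  · intro t x ht0 htT
    exact hasDerivAt_solution_x hω hωx (hyt t htT) (hst t ht0) x
  · intro t x ht0 htT
    exact hasDerivAt_solution_xx hωx hωxx (hyt t htT) (hst t ht0) x
  · intro t x ht0 htT
    exact hasDerivAt_solution_t hk hs hy hω hωxx (hrad t ht0) (hyt t htT) x
  · intro t x
    exact solution_odd hω t x
  · intro t x ht0 htT hx
    exact solution_nonpos hν hk0 hω (hyt t htT) (hst t ht0) hx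
  · intro x
    refine (solution_initial_abs_le hν hk0 hk6 hL hs hy hω x).trans ?_
    -- `123ν/L² ≤ ε` since `L ≥ √(123ν/ε)`
    have hL2 : 123 * ν / ε ≤ L ^ 2 := by
      have h1 : Real.sqrt (123 * ν / ε) ≤ L := by
        rw [hLdef]
        have : 0 ≤ 672 * ν / ε := by positivity
        linarith
      have h2 : 0 ≤ Real.sqrt (123 * ν / ε) := Real.sqrt_nonneg _
      calc 123 * ν / ε = Real.sqrt (123 * ν / ε) ^ 2 := (Real.sq_sqrt (by positivity)).symm
        _ ≤ L ^ 2 := by gcongr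
    rw [div_le_iff₀ (by positivity)]
    have := (div_le_iff₀ hε).1 hL2
    linarith
  · -- every slice is in `L¹`
    intro t ht0 htT
    exact integrable_solution hν hk0 hω (hyt t htT) (hst t ht0)
      (continuous_iff_continuousAt.2 fun x =>
        (hasDerivAt_solution_x hω hωx (hyt t htT) (hst t ht0) x).continuousAt)
  · -- `‖ω₀‖₁ ≤ 24(k+1)νπ/L ≤ 672ν/L ≤ ε`
    have hy0 : y 0 = L := by
      rw [hy, hs]
      simp [Real.sqrt_sq hL.le]
      ring
    have hI := integral_abs_solution_le hν hk0 hω (hyt 0 hT) (hst 0 le_rfl)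
      (continuous_iff_continuousAt.2 fun x =>
        (hasDerivAt_solution_x hω hωx (hyt 0 hT) (hst 0 le_rfl) x).continuousAt)
    rw [hy0] at hI
    refine hI.trans ?_
    have hLge : 672 * ν / ε ≤ L := by
      rw [hLdef]
      have : 0 ≤ Real.sqrt (123 * ν / ε) := Real.sqrt_nonneg _
      linarith
    have h672 : 672 * ν / L ≤ ε := by
      rw [div_le_iff₀ hL]
      have := (div_le_iff₀ hε).1 hLge
      linarith
    refine le_trans ?_ h672
    rw [mul_div_assoc']
    rw [div_le_div_iff₀ hL hL]
    have hpi := Real.pi_le_four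
    have hkk : k + 1 ≤ 7 := by linarith
    have h1 : (k + 1) * π ≤ 28 := by
      nlinarith [mul_nonneg (sub_nonneg.2 hkk) Real.pi_pos.le, mul_nonneg (sub_nonneg.2 hpi) (by linarith : (0:ℝ) ≤ k + 1)]
    have hνL := mul_pos hν hL
    nlinarith [mul_le_mul_of_nonneg_right h1 hνL.le]
  · -- the two-sided `(T − t)^{−2}` rate
    have h3L : L < 3 * L := by linarith
    refine ⟨3 * (3 * L) ^ 2 / (200 * k ^ 2 * ν),
      12 * (3 * L) * (((3 * L) ^ 2 - L ^ 2) / (40 * k * ν)) / (5 * L) + 6 * (3 * L) ^ 2 / (25 * k ^ 2 * ν),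
      by positivity, fun t ht0 htT => ⟨⟨y t, ?_⟩, fun x => ?_⟩⟩
    · exact solution_rate_lower hν hk0 hL h3L hs hy hω ht0 htT
    · exact solution_rate_upper hν hk0 hL h3L hs hy hω ht0 htT x
  · -- `ωₓ(t,0) ≤ −24ν/y³ → −∞`
    have hup : Tendsto (fun t => -(24 * ν / y t ^ 3)) (𝓝[<] (((3 * L) ^ 2 - L ^ 2) / (40 * k * ν))) atBot :=
      tendsto_neg_atTop_atBot.comp (tendsto_inv_depth_pow hν hk0 hσ hs hy (n := 3) (by norm_num) (by positivity))
    refine tendsto_atBot_mono' _ ?_ hup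
    have hpos : ∀ᶠ t in 𝓝[<] (((3 * L) ^ 2 - L ^ 2) / (40 * k * ν)), 0 < t :=
      (lt_mem_nhds hT).filter_mono nhdsWithin_le_nhds
    filter_upwards [hpos, self_mem_nhdsWithin] with t ht0 htT
    exact solution_x_zero_le hν hk0 hωx (hyt t htT) (hst t ht0.le)
  · -- `|ω(t, y(t))| ≥ 6ν/y² → ∞`
    intro M
    have hup := tendsto_inv_depth_pow hν hk0 hσ hs hy (n := 2) (by norm_num) (by positivity : (0:ℝ) < 6 * ν)
    have hpos : ∀ᶠ t in 𝓝[<] (((3 * L) ^ 2 - L ^ 2) / (40 * k * ν)), 0 < t :=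
      (lt_mem_nhds hT).filter_mono nhdsWithin_le_nhds
    filter_upwards [hpos, self_mem_nhdsWithin, hup.eventually_ge_atTop M] with t ht0 htT hM
    refine ⟨y t, hM.trans ?_⟩
    have h := solution_at_depth_le hν hk0 hω (hyt t htT) (hst t ht0.le)
    have hnn : 0 ≤ 6 * ν / y t ^ 2 := by
      have := hyt t htT
      positivity
    rw [abs_of_nonpos (h.trans (neg_nonpos.2 hnn))]
    linarith

end SheetNSLineSchochetTwoPole
end Summit.NavierStokesRegularity.OSWSelfSimilar

end
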